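import Summits.RiemannHypothesis.RiemannHypothesis.Theorems.PfPersistenceDilatingLandauWeightedAbel
import HarnessLib

/-!
# LANDAU for the weighted dilating statistic `S(x) = Σ_{n ≤ x} Λ(n)/√n` — VI: the zero sum under RH

Cell `pub-rhpf` (mechanism/rigidity campaign; **no RH claims**), CAND SEAT 7 gen 8, CASE-DAG v6 §6
kernel target LANDAU, weighted statistic `S`. Continuing file IV
(`PfPersistenceDilatingLandauWeightedAbel`): under RH the integral
`∫_{(1,x]} t^{-5/2} D(t) dt`, `D = ψ₁ − t²/2`, is BOUNDED in `x`, because after the explicit formula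
(MV (13.7)) the zero sum integrates term by term to `Σ_ρ m(ρ) (x^{ρ−1/2} − 1)/(ρ(ρ+1)(ρ−1/2))`, of
modulus `≤ 2 Σ_ρ m(ρ)/|γ|³ < ∞` on the critical line (`exists_norm_integral_zeroSum_le_of_riemannHypothesis`);
the `−t log 2π` and `E(t) = O(√t)` pieces integrate absolutely. Consequently

* `exists_abs_psiRemInt_le_of_riemannHypothesis`: RH ⇒ `J(x) = ∫_{(1,x]} t^{-3/2}(ψ(t) − t) dt = O(1)`;
* `exists_abs_wpsiErr_sub_le_of_riemannHypothesis`: **RH ⇒ `S(x) − 2√x = (ψ(x) − x)/√x + O(1)`**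
  (`|S(x) − 2√x − x^{-1/2}(ψ(x) − x)| ≤ K` for all `x ≥ 1`).

This is the transfer lemma that carries Littlewood's `Ω±(√x log log log x)` for `ψ(x) − x` over to
`S(x) − 2√x = Ω±(log log log x)` (file VII). `RiemannHypothesis` appears only as an explicit
hypothesis; sorry-free.

References: [MontgomeryVaughan2007] H. L. Montgomery, R. C. Vaughan, *Multiplicative Number Theory I*,
CUP 2007, §13.1 ((13.7)–(13.8), Thm. 13.1).
-/

noncomputable section

-- the sub-problem path RiemannHypothesis/RiemannHypothesis duplicates a namespace (D-0017)
set_option linter.dupNamespace false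

open Filter Topology Set MeasureTheory

namespace Summit.RiemannHypothesis.RiemannHypothesis.Theorems.PfPersistenceDilatingLandauWeightedZeroSum

open Literature.NumberTheory.LFunctions
open Summit.RiemannHypothesis.RiemannHypothesis.Theorems.PfPersistenceDilatingLandauWeightedMellin
open Summit.RiemannHypothesis.RiemannHypothesis.Theorems.PfPersistenceDilatingLandauWeightedAbel

/-! ## §9 The terms of the zero sum -/

/-- The summand `z(t, ρ) = m(ρ) t^{ρ+1}/(ρ(ρ+1))` of the explicit formula for `ψ₁`. [cite: MontgomeryVaughan2007, §13.1 (13.7)] -/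
def zterm (t : ℝ) (ρ : ℂ) : ℂ := (riemannZetaZeroOrder ρ : ℂ) * ((t : ℂ) ^ (ρ + 1) / (ρ * (ρ + 1)))

/-- `psiOneZeroSum t = Σ_ρ z(t, ρ)`. [folklore] -/
theorem psiOneZeroSum_eq (t : ℝ) :
    psiOneZeroSum t = ∑' ρ : RHWave0.riemannZetaNontrivialZeros, zterm t ρ := rfl

/-- `‖z(t, ρ)‖ = m(ρ) t^{Re ρ + 1}/(|ρ| |ρ+1|)` for `t > 0`. [folklore] -/
theorem norm_zterm {t : ℝ} (ht : 0 < t) (ρ : RHWave0.riemannZetaNontrivialZeros) :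
    ‖zterm t ρ‖ = (riemannZetaZeroOrder (ρ : ℂ) : ℝ) *
      (t ^ ((ρ : ℂ).re + 1) / (‖(ρ : ℂ)‖ * ‖(ρ : ℂ) + 1‖)) := by
  have hm := ZetaZeroSum.zeroOrder_nonneg ρ
  rw [zterm, norm_mul, Complex.norm_intCast, abs_of_nonneg hm, norm_div, norm_mul,
    Complex.norm_cpow_eq_rpow_re_of_pos ht, Complex.add_re, Complex.one_re]

/-- `‖z(t, ρ)‖ ≤ ‖z(x, ρ)‖` for `0 < t ≤ x` (the exponent `Re ρ + 1` is positive). [folklore] -/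
theorem norm_zterm_mono {t x : ℝ} (ht : 0 < t) (htx : t ≤ x)
    (ρ : RHWave0.riemannZetaNontrivialZeros) : ‖zterm t ρ‖ ≤ ‖zterm x ρ‖ := by
  have hx : 0 < x := lt_of_lt_of_le ht htx
  rw [norm_zterm ht, norm_zterm hx]
  have hre := ZetaZeros.riemannZetaNontrivialZeros.re_pos ρ.2
  refine mul_le_mul_of_nonneg_left (div_le_div_of_nonneg_right
    (Real.rpow_le_rpow ht.le htx (by linarith)) (by positivity)) (ZetaZeroSum.zeroOrder_nonneg ρ)

/-- `t ↦ z(t, ρ)` is continuous on `(0, ∞)`. [folklore] -/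
theorem continuousOn_zterm (ρ : ℂ) : ContinuousOn (fun t : ℝ ↦ zterm t ρ) (Ioi 0) := by
  intro t ht
  have h := Complex.continuousAt_ofReal_cpow_const t (ρ + 1) (Or.inr (ne_of_gt ht))
  unfold zterm
  exact (continuousAt_const.mul (h.div_const _)).continuousWithinAt

/-- The zero sum `Σ_ρ z(t, ρ)` is continuous on `[1, x]` (uniform absolute convergence).
[cite: MontgomeryVaughan2007, §13.1 (13.7)] -/
theorem continuousOn_psiOneZeroSum {x : ℝ} (hx : 1 ≤ x) : ContinuousOn psiOneZeroSum (Icc 1 x) := by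
  have hsum : Summable fun ρ : RHWave0.riemannZetaNontrivialZeros ↦ ‖zterm x ρ‖ :=
    summable_norm_psiOne_zeroTerm hx
  have h := continuousOn_tsum
    (fun ρ : RHWave0.riemannZetaNontrivialZeros ↦ (continuousOn_zterm (ρ : ℂ)).mono
      (fun t (ht : t ∈ Icc 1 x) ↦ show (0 : ℝ) < t by linarith [ht.1])) hsum
    (fun (ρ : RHWave0.riemannZetaNontrivialZeros) t ht ↦ norm_zterm_mono (by linarith [ht.1]) ht.2 ρ)
  exact h.congr fun t _ ↦ psiOneZeroSum_eq t

/-- The termwise integral: for `x ≥ 1` and a non-trivial zero `ρ`,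
`∫_{(1,x]} t^{-5/2} z(t, ρ) dt = m(ρ)/(ρ(ρ+1)) · (x^{ρ−1/2} − 1)/(ρ − 1/2)`. [folklore] -/
theorem integral_rpow_mul_zterm {x : ℝ} (hx : 1 ≤ x) (ρ : RHWave0.riemannZetaNontrivialZeros) :
    ∫ t in Ioc 1 x, ((t ^ (-(5 / 2 : ℝ)) : ℝ) : ℂ) * zterm t ρ =
      (riemannZetaZeroOrder (ρ : ℂ) : ℂ) / ((ρ : ℂ) * (ρ + 1)) *
        (((x : ℂ) ^ ((ρ : ℂ) - ((1 / 2 : ℝ) : ℂ)) - 1) / ((ρ : ℂ) - ((1 / 2 : ℝ) : ℂ))) := by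
  set r : ℂ := (ρ : ℂ) - ((3 / 2 : ℝ) : ℂ) with hr
  have hr1 : r + 1 = (ρ : ℂ) - ((1 / 2 : ℝ) : ℂ) := by
    rw [hr]; push_cast; ring
  have hpt : ∀ t ∈ Ioc 1 x, ((t ^ (-(5 / 2 : ℝ)) : ℝ) : ℂ) * zterm t ρ =
      (riemannZetaZeroOrder (ρ : ℂ) : ℂ) / ((ρ : ℂ) * (ρ + 1)) * (t : ℂ) ^ r := by
    intro t ht
    have ht0 : 0 < t := by linarith [ht.1]
    have ht0' : (t : ℂ) ≠ 0 := Complex.ofReal_ne_zero.2 ht0.ne'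
    rw [Complex.ofReal_cpow ht0.le, zterm]
    have hexp : (t : ℂ) ^ (((-(5 / 2 : ℝ)) : ℝ) : ℂ) * (t : ℂ) ^ ((ρ : ℂ) + 1) = (t : ℂ) ^ r := by
      rw [← Complex.cpow_add _ _ ht0', hr]
      congr 1
      push_cast
      ring
    rw [← hexp]
    field_simp
  have hne : r ≠ -1 := by
    intro h
    have him := ZetaZeros.riemannZetaNontrivialZeros.im_ne_zero ρ.2
    have := congrArg Complex.im h
    rw [hr] at this
    simp at this
    exact him this
  have h0 : (0 : ℝ) ∉ Set.uIcc 1 x := by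
    rw [Set.uIcc_of_le hx]; intro h; linarith [h.1]
  rw [setIntegral_congr_fun measurableSet_Ioc hpt, integral_const_mul,
    ← intervalIntegral.integral_of_le hx, integral_cpow (Or.inr ⟨hne, h0⟩), hr1]
  push_cast
  rw [Complex.one_cpow]

/-- `1/|γ|³ ≤ K/(1 + γ²)` when `|γ| ≥ g₀ > 0`, with `K = (g₀² + 1)/g₀³`. [folklore] -/
theorem inv_cube_le {g₀ u : ℝ} (hg : 0 < g₀) (hu : g₀ ≤ u) :
    1 / u ^ 3 ≤ (g₀ ^ 2 + 1) / g₀ ^ 3 / (1 + u ^ 2) := by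
  have hu0 : 0 < u := lt_of_lt_of_le hg hu
  rw [div_div, div_le_div_iff₀ (by positivity) (by positivity), one_mul]
  have h3 : g₀ ^ 3 ≤ u ^ 3 := pow_le_pow_left₀ hg.le hu 3
  nlinarith [mul_le_mul_of_nonneg_left hu (by positivity : (0 : ℝ) ≤ g₀ ^ 2 * u ^ 2)]

/-! ## §10 The zero-sum integral is bounded under RH -/

/-- **Under RH, `‖∫_{(1,x]} t^{-5/2} Σ_ρ z(t,ρ) dt‖ ≤ K` for all `x ≥ 1`:** term by term the integral
is `Σ_ρ m(ρ)(x^{iγ} − 1)/(ρ(ρ+1) iγ)`, of modulus `≤ 2 Σ_ρ m(ρ)/|γ|³`. [cite: MontgomeryVaughan2007, §13.1 (13.7)–(13.8)] -/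
theorem exists_norm_integral_zeroSum_le_of_riemannHypothesis (hRH : RiemannHypothesis) :
    ∃ K : ℝ, ∀ x : ℝ, 1 ≤ x →
      ‖∫ t in Ioc 1 x, ((t ^ (-(5 / 2 : ℝ)) : ℝ) : ℂ) * psiOneZeroSum t‖ ≤ K := by
  haveI : Countable RHWave0.riemannZetaNontrivialZeros :=
    (inferInstance : Countable ZetaZeros.riemannZetaNontrivialZeros)
  obtain ⟨δ, hδ, -, hgap⟩ := ZetaZeroSum.exists_gap_im
  set g₀ : ℝ := 2 * δ with hg₀
  have hg₀pos : 0 < g₀ := by positivity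
  set K : ℝ := (g₀ ^ 2 + 1) / g₀ ^ 3 with hK
  have hS := ZetaZeroSum.summable_zeroOrder_div_one_add_sq
  refine ⟨∑' ρ : RHWave0.riemannZetaNontrivialZeros,
    2 * K * ((riemannZetaZeroOrder (ρ : ℂ) : ℝ) / (1 + (ρ : ℂ).im ^ 2)), fun x hx ↦ ?_⟩
  have hx0 : 0 < x := by linarith
  set F : RHWave0.riemannZetaNontrivialZeros → ℝ → ℂ :=
    fun ρ t ↦ ((t ^ (-(5 / 2 : ℝ)) : ℝ) : ℂ) * zterm t ρ with hF
  have hpow : ContinuousOn (fun t : ℝ ↦ ((t ^ (-(5 / 2 : ℝ)) : ℝ) : ℂ)) (Icc 1 x) :=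
    Complex.continuous_ofReal.comp_continuousOn
      (ContinuousOn.rpow_const (by fun_prop) fun t ht ↦ Or.inl (by linarith [ht.1] : t ≠ 0))
  have hF_int : ∀ ρ, Integrable (F ρ) (volume.restrict (Ioc 1 x)) := fun ρ ↦
    ((hpow.mul ((continuousOn_zterm (ρ : ℂ)).mono fun t (ht : t ∈ Icc 1 x) ↦
      show (0 : ℝ) < t by linarith [ht.1])).integrableOn_Icc).mono_set Ioc_subset_Icc_self
  -- `‖F ρ t‖ ≤ ‖z(x, ρ)‖` on `(1, x]`
  have hsumx : Summable fun ρ : RHWave0.riemannZetaNontrivialZeros ↦ ‖zterm x ρ‖ :=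
    summable_norm_psiOne_zeroTerm hx
  have hFle : ∀ ρ, ∀ t ∈ Ioc 1 x, ‖F ρ t‖ ≤ ‖zterm x ρ‖ := by
    intro ρ t ht
    have ht0 : 0 < t := by linarith [ht.1]
    rw [hF, norm_mul, Complex.norm_real, Real.norm_eq_abs,
      abs_of_pos (Real.rpow_pos_of_pos ht0 _)]
    calc t ^ (-(5 / 2 : ℝ)) * ‖zterm t ρ‖ ≤ 1 * ‖zterm x ρ‖ :=
          mul_le_mul (Real.rpow_le_one_of_one_le_of_nonpos ht.1.le (by norm_num))
            (norm_zterm_mono ht0 ht.2 ρ) (norm_nonneg _) zero_le_one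
      _ = ‖zterm x ρ‖ := one_mul _
  have hF_sum : Summable fun ρ ↦ ∫ t in Ioc 1 x, ‖F ρ t‖ := by
    refine (hsumx.mul_left (x - 1)).of_nonneg_of_le
      (fun ρ ↦ integral_nonneg fun t ↦ norm_nonneg _) fun ρ ↦ ?_
    calc ∫ t in Ioc 1 x, ‖F ρ t‖ ≤ ∫ _ in Ioc 1 x, ‖zterm x ρ‖ :=
          setIntegral_mono_on (hF_int ρ).norm (integrableOn_const (by simp)) measurableSet_Ioc
            (hFle ρ)
      _ = (x - 1) * ‖zterm x ρ‖ := by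
          rw [setIntegral_const, Real.volume_real_Ioc_of_le hx, smul_eq_mul]
  -- interchange
  have hswap := integral_tsum_of_summable_integral_norm hF_int hF_sum
  have htsum : ∀ t, ∑' ρ, F ρ t = ((t ^ (-(5 / 2 : ℝ)) : ℝ) : ℂ) * psiOneZeroSum t := fun t ↦ by
    simp only [hF]
    rw [tsum_mul_left, psiOneZeroSum_eq]
  simp_rw [htsum] at hswap
  rw [← hswap]
  -- termwise bound `‖∫ F ρ‖ ≤ 2K m/(1+γ²)`
  have hterm : ∀ ρ : RHWave0.riemannZetaNontrivialZeros, ‖∫ t in Ioc 1 x, F ρ t‖ ≤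
      2 * K * ((riemannZetaZeroOrder (ρ : ℂ) : ℝ) / (1 + (ρ : ℂ).im ^ 2)) := by
    intro ρ
    have hm := ZetaZeroSum.zeroOrder_nonneg ρ
    have hre : (ρ : ℂ).re = 1 / 2 := by
      refine hRH _ (ZetaZeros.riemannZetaNontrivialZeros.zeta_eq_zero ρ.2) ?_
        (ZetaZeros.riemannZetaNontrivialZeros.ne_one ρ.2)
      rintro ⟨n, hn⟩
      have := ZetaZeros.riemannZetaNontrivialZeros.re_pos ρ.2
      rw [hn] at this
      simp at this
      linarith [(n.cast_nonneg : (0 : ℝ) ≤ n)]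
    have hγ : g₀ ≤ |(ρ : ℂ).im| := hgap _ ρ.2
    have hγ0 : 0 < |(ρ : ℂ).im| := lt_of_lt_of_le hg₀pos hγ
    have h1 : |(ρ : ℂ).im| ≤ ‖(ρ : ℂ)‖ := Complex.abs_im_le_norm _
    have h2 : |(ρ : ℂ).im| ≤ ‖(ρ : ℂ) + 1‖ := by
      have := Complex.abs_im_le_norm ((ρ : ℂ) + 1)
      simpa using this
    have h3 : |(ρ : ℂ).im| ≤ ‖(ρ : ℂ) - ((1 / 2 : ℝ) : ℂ)‖ := by
      have := Complex.abs_im_le_norm ((ρ : ℂ) - ((1 / 2 : ℝ) : ℂ))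
      simpa using this
    have hxρ : ‖(x : ℂ) ^ ((ρ : ℂ) - ((1 / 2 : ℝ) : ℂ))‖ = 1 := by
      rw [Complex.norm_cpow_eq_rpow_re_of_pos hx0, Complex.sub_re, Complex.ofReal_re, hre,
        sub_self, Real.rpow_zero]
    have hnum : ‖(x : ℂ) ^ ((ρ : ℂ) - ((1 / 2 : ℝ) : ℂ)) - 1‖ ≤ 2 := by
      refine (norm_sub_le _ _).trans (le_of_eq ?_)
      rw [hxρ, norm_one]; norm_num
    rw [show (fun t ↦ F ρ t) = fun t ↦ ((t ^ (-(5 / 2 : ℝ)) : ℝ) : ℂ) * zterm t ρ from rfl,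
      integral_rpow_mul_zterm hx ρ, norm_mul, norm_div, norm_div, norm_mul, Complex.norm_intCast,
      abs_of_nonneg hm]
    have hu3 : 1 / |(ρ : ℂ).im| ^ 3 ≤ K / (1 + (ρ : ℂ).im ^ 2) := by
      have := inv_cube_le hg₀pos hγ
      rwa [sq_abs] at this
    calc (riemannZetaZeroOrder (ρ : ℂ) : ℝ) / (‖(ρ : ℂ)‖ * ‖(ρ : ℂ) + 1‖) *
          (‖(x : ℂ) ^ ((ρ : ℂ) - ((1 / 2 : ℝ) : ℂ)) - 1‖ / ‖(ρ : ℂ) - ((1 / 2 : ℝ) : ℂ)‖)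
        ≤ (riemannZetaZeroOrder (ρ : ℂ) : ℝ) / (|(ρ : ℂ).im| * |(ρ : ℂ).im|) *
            (2 / |(ρ : ℂ).im|) := by
          gcongr
      _ = 2 * (riemannZetaZeroOrder (ρ : ℂ) : ℝ) * (1 / |(ρ : ℂ).im| ^ 3) := by
          field_simp
      _ ≤ 2 * (riemannZetaZeroOrder (ρ : ℂ) : ℝ) * (K / (1 + (ρ : ℂ).im ^ 2)) :=
          mul_le_mul_of_nonneg_left hu3 (by positivity)
      _ = 2 * K * ((riemannZetaZeroOrder (ρ : ℂ) : ℝ) / (1 + (ρ : ℂ).im ^ 2)) := by ring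
  have hnsum : Summable fun ρ : RHWave0.riemannZetaNontrivialZeros ↦ ‖∫ t in Ioc 1 x, F ρ t‖ :=
    (hS.mul_left (2 * K)).of_nonneg_of_le (fun ρ ↦ norm_nonneg _) hterm
  exact (norm_tsum_le_tsum_norm hnsum).trans (hnsum.tsum_le_tsum hterm (hS.mul_left (2 * K)))

/-! ## §11 `J(x) = O(1)` and `S(x) − 2√x = (ψ(x) − x)/√x + O(1)` under RH -/

/-- `∫_{(1,x]} t^{-3/2} dt ≤ 2` (`x ≥ 1`). [folklore] -/
theorem integral_rpow_neg_three_halves_le {x : ℝ} (hx : 1 ≤ x) :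
    ∫ t in Ioc 1 x, t ^ (-(3 / 2 : ℝ)) ≤ 2 := by
  have h0 : (0 : ℝ) ∉ Set.uIcc 1 x := by
    rw [Set.uIcc_of_le hx]; intro h; linarith [h.1]
  rw [← intervalIntegral.integral_of_le hx, integral_rpow (Or.inr ⟨by norm_num, h0⟩), Real.one_rpow]
  have hx0 : 0 < x := by linarith
  have h1 : 0 ≤ x ^ (-(3 / 2 : ℝ) + 1) := (Real.rpow_pos_of_pos hx0 _).le
  norm_num at h1 ⊢
  rw [div_le_iff_of_neg (by norm_num)]
  linarith

/-- **Under RH, `|∫_{(1,x]} t^{-5/2} D(t) dt| ≤ K` for all `x ≥ 1`.** [cite: MontgomeryVaughan2007, §13.1 (13.7)–(13.8)] -/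
theorem exists_abs_integral_psiOneErr_le_of_riemannHypothesis (hRH : RiemannHypothesis) :
    ∃ K : ℝ, ∀ x : ℝ, 1 ≤ x → |∫ t in Ioc 1 x, t ^ (-(5 / 2 : ℝ)) * psiOneErr t| ≤ K := by
  obtain ⟨K₃, hK₃⟩ := exists_norm_integral_zeroSum_le_of_riemannHypothesis hRH
  obtain ⟨CE, hCE0, hCE⟩ := exists_norm_psiOneRemainder_le
  refine ⟨2 * CE + K₃ + 7 * 2, fun x hx ↦ ?_⟩
  have hx0 : 0 < x := by linarith
  have hcpow : ∀ a : ℝ, ContinuousOn (fun t : ℝ ↦ t ^ a) (Icc 1 x) := fun a ↦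
    ContinuousOn.rpow_const (by fun_prop) fun t ht ↦ Or.inl (by linarith [ht.1] : t ≠ 0)
  have hIpow : ∀ a : ℝ, IntegrableOn (fun t : ℝ ↦ t ^ a) (Ioc 1 x) := fun a ↦
    (hcpow a).integrableOn_Icc.mono_set Ioc_subset_Icc_self
  -- the three integrable pieces
  set f₀ : ℝ → ℝ := fun t ↦ t ^ (-(5 / 2 : ℝ)) * psiOneErr t with hf₀
  set f₁ : ℝ → ℝ := fun t ↦ t ^ (-(5 / 2 : ℝ)) * (psiOneZeroSum t).re with hf₁
  set f₂ : ℝ → ℝ := fun t ↦ Real.log (2 * Real.pi) * t ^ (-(3 / 2 : ℝ)) with hf₂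
  set f₃ : ℝ → ℝ := fun t ↦ f₀ t + f₁ t + f₂ t with hf₃
  have hI₀ : IntegrableOn f₀ (Ioc 1 x) :=
    (((hcpow _).mul continuous_psiOneErr.continuousOn)).integrableOn_Icc.mono_set Ioc_subset_Icc_self
  have hZc : ContinuousOn (fun t : ℝ ↦ ((t ^ (-(5 / 2 : ℝ)) : ℝ) : ℂ) * psiOneZeroSum t) (Icc 1 x) :=
    (Complex.continuous_ofReal.comp_continuousOn (hcpow _)).mul (continuousOn_psiOneZeroSum hx)
  have hIZ : IntegrableOn (fun t : ℝ ↦ ((t ^ (-(5 / 2 : ℝ)) : ℝ) : ℂ) * psiOneZeroSum t) (Ioc 1 x) :=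
    hZc.integrableOn_Icc.mono_set Ioc_subset_Icc_self
  have hI₁ : IntegrableOn f₁ (Ioc 1 x) := by
    have h : IntegrableOn (fun t : ℝ ↦ RCLike.re (((t ^ (-(5 / 2 : ℝ)) : ℝ) : ℂ) * psiOneZeroSum t))
        (Ioc 1 x) := hIZ.re
    refine h.congr_fun (fun t _ ↦ ?_) measurableSet_Ioc
    simp only [hf₁, RCLike.re_to_complex, Complex.re_ofReal_mul]
  have hI₂ : IntegrableOn f₂ (Ioc 1 x) := (hIpow _).const_mul _
  have hI₃ : IntegrableOn f₃ (Ioc 1 x) := (hI₀.add hI₁).add hI₂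
  -- `f₃ = t^{-5/2} Re E(t)` pointwise, `|f₃| ≤ CE t^{-3/2}`
  have hf₃E : ∀ t ∈ Ioc 1 x, f₃ t = t ^ (-(5 / 2 : ℝ)) * (psiOneRemainder t).re := by
    intro t ht
    have ht0 : 0 < t := by linarith [ht.1]
    have h32 : t ^ (-(5 / 2 : ℝ)) * t = t ^ (-(3 / 2 : ℝ)) := by
      calc t ^ (-(5 / 2 : ℝ)) * t = t ^ (-(5 / 2 : ℝ)) * t ^ (1 : ℝ) := by rw [Real.rpow_one]
        _ = t ^ (-(3 / 2 : ℝ)) := by rw [← Real.rpow_add ht0]; norm_num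
    simp only [hf₃, hf₀, hf₁, hf₂]
    rw [psiOneErr_eq_re ht.1.le, ← h32]
    ring
  have hf₃le : ∀ t ∈ Ioc 1 x, ‖f₃ t‖ ≤ CE * t ^ (-(3 / 2 : ℝ)) := by
    intro t ht
    have ht0 : 0 < t := by linarith [ht.1]
    rw [hf₃E t ht, Real.norm_eq_abs, abs_mul, abs_of_pos (Real.rpow_pos_of_pos ht0 _)]
    have hE : |(psiOneRemainder t).re| ≤ CE * Real.sqrt t :=
      (Complex.abs_re_le_norm _).trans (hCE t ht0)
    have hst : t ^ (-(5 / 2 : ℝ)) * Real.sqrt t ≤ t ^ (-(3 / 2 : ℝ)) := by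
      rw [Real.sqrt_eq_rpow, ← Real.rpow_add ht0]
      exact Real.rpow_le_rpow_of_exponent_le ht.1.le (by norm_num)
    calc t ^ (-(5 / 2 : ℝ)) * |(psiOneRemainder t).re| ≤ t ^ (-(5 / 2 : ℝ)) * (CE * Real.sqrt t) :=
          mul_le_mul_of_nonneg_left hE (Real.rpow_pos_of_pos ht0 _).le
      _ = CE * (t ^ (-(5 / 2 : ℝ)) * Real.sqrt t) := by ring
      _ ≤ CE * t ^ (-(3 / 2 : ℝ)) := mul_le_mul_of_nonneg_left hst hCE0.le
  have h32 := integral_rpow_neg_three_halves_le hx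
  have hb₃ : ‖∫ t in Ioc 1 x, f₃ t‖ ≤ 2 * CE := by
    refine (norm_integral_le_of_norm_le ((hIpow (-(3 / 2 : ℝ))).const_mul CE) ?_).trans ?_
    · exact (ae_restrict_iff' measurableSet_Ioc).2 (Eventually.of_forall hf₃le)
    · rw [integral_const_mul]; nlinarith
  have hb₁ : |∫ t in Ioc 1 x, f₁ t| ≤ K₃ := by
    have hre : ∫ t in Ioc 1 x, f₁ t =
        (∫ t in Ioc 1 x, ((t ^ (-(5 / 2 : ℝ)) : ℝ) : ℂ) * psiOneZeroSum t).re := by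
      have h := integral_re hIZ
      simp only [RCLike.re_to_complex, Complex.re_ofReal_mul] at h
      exact h
    rw [hre]
    exact (Complex.abs_re_le_norm _).trans (hK₃ x hx)
  have hb₂ : |∫ t in Ioc 1 x, f₂ t| ≤ 7 * 2 := by
    simp only [hf₂]
    rw [integral_const_mul, abs_mul, abs_of_nonneg (Real.log_nonneg (by linarith [Real.pi_gt_three])),
      abs_of_nonneg (setIntegral_nonneg measurableSet_Ioc fun t ht ↦
        (Real.rpow_pos_of_pos (by linarith [ht.1]) _).le)]
    exact mul_le_mul log_two_pi_le h32 (setIntegral_nonneg measurableSet_Ioc fun t ht ↦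
        (Real.rpow_pos_of_pos (by linarith [ht.1]) _).le) (by norm_num)
  -- assemble: `f₀ = f₃ − f₁ − f₂`
  have hsplit : ∫ t in Ioc 1 x, f₀ t =
      (∫ t in Ioc 1 x, f₃ t) - (∫ t in Ioc 1 x, f₁ t) - ∫ t in Ioc 1 x, f₂ t := by
    have h01 : IntegrableOn (fun t ↦ f₀ t + f₁ t) (Ioc 1 x) := hI₀.add hI₁
    have e1 := integral_add hI₀ hI₁
    have e2 := integral_add h01 hI₂
    beta_reduce at e2
    have e3 : ∫ t in Ioc 1 x, f₃ t = ∫ t in Ioc 1 x, f₀ t + f₁ t + f₂ t := by simp only [hf₃]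
    rw [e3, e2, e1]
    ring
  rw [hsplit]
  have := Real.norm_eq_abs _ ▸ hb₃
  rw [abs_le] at this hb₁ hb₂ ⊢
  constructor <;> linarith [this.1, this.2, hb₁.1, hb₁.2, hb₂.1, hb₂.2]

/-- **Under RH, `J(x) = ∫_{(1,x]} t^{-3/2}(ψ(t) − t) dt` is bounded** (`x ≥ 1`). [cite: MontgomeryVaughan2007, §13.1, Thm. 13.1] -/
theorem exists_abs_psiRemInt_le_of_riemannHypothesis (hRH : RiemannHypothesis) :
    ∃ K : ℝ, ∀ x : ℝ, 1 ≤ x → |psiRemInt x| ≤ K := by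
  obtain ⟨K₁, hK₁0, hK₁⟩ := exists_abs_psiOneErr_le_of_riemannHypothesis hRH
  obtain ⟨K₂, hK₂⟩ := exists_abs_integral_psiOneErr_le_of_riemannHypothesis hRH
  refine ⟨K₁ + 1 / 2 + 3 / 2 * K₂, fun x hx ↦ ?_⟩
  have hx0 : 0 < x := by linarith
  rw [psiRemInt_eq_parts hx]
  have h1 : |x ^ (-(3 / 2 : ℝ)) * psiOneErr x| ≤ K₁ := by
    rw [abs_mul, abs_of_pos (Real.rpow_pos_of_pos hx0 _)]
    calc x ^ (-(3 / 2 : ℝ)) * |psiOneErr x| ≤ x ^ (-(3 / 2 : ℝ)) * (K₁ * x ^ (3 / 2 : ℝ)) :=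
          mul_le_mul_of_nonneg_left (hK₁ x hx) (Real.rpow_pos_of_pos hx0 _).le
      _ = K₁ := by
          rw [mul_comm K₁, ← mul_assoc, ← Real.rpow_add hx0]; norm_num
  have h2 := hK₂ x hx
  have hK₂0 : 0 ≤ K₂ := (abs_nonneg _).trans h2
  rw [abs_le] at h1 h2 ⊢
  constructor <;> nlinarith [h1.1, h1.2, h2.1, h2.2]

/-- **RH ⇒ `S(x) − 2√x = x^{-1/2}(ψ(x) − x) + O(1)`:** there is `K` with
`|S(x) − 2√x − x^{-1/2}(ψ(x) − x)| ≤ K` for all `x ≥ 1`. [cite: MontgomeryVaughan2007, Thm. 13.1, (13.7)–(13.8)] -/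
theorem exists_abs_wpsiErr_sub_le_of_riemannHypothesis (hRH : RiemannHypothesis) :
    ∃ K : ℝ, ∀ x : ℝ, 1 ≤ x →
      |wpsiErr x - x ^ (-(1 / 2 : ℝ)) * (Chebyshev.psi x - x)| ≤ K := by
  obtain ⟨K, hK⟩ := exists_abs_psiRemInt_le_of_riemannHypothesis hRH
  refine ⟨K / 2 + 1, fun x hx ↦ ?_⟩
  rw [wpsiErr_eq_psi_add hx]
  have h := hK x hx
  rw [abs_le] at h ⊢
  constructor <;> linarith [h.1, h.2]

end Summit.RiemannHypothesis.RiemannHypothesis.Theorems.PfPersistenceDilatingLandauWeightedZeroSum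

end
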